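import Mathlib
import HarnessLib
import Summits.ValiantsHypothesis.ValiantsHypothesis.Theorems.LacunarySymmetroidMatrixDescartesProductPlusOneCrossingBudget

/-!
# ValiantsHypothesis / LacunarySymmetroid — crux `MatrixDescartes` (stmt-ValiantsHypothesis-18050, V1),
# LINE (A) «product_plus_one», floor (both couplings): the LOCAL crossing budget on one pole-free interval

Local form of ✓ `euler_pos_roots_le_budget` (`…ProductPlusOneCrossingBudget`): for EVERY product `P = ∏ f_j`, every level `ν`, Euler
polynomial `E = X·P′ − C ν·P`, and every interval `[u, v]` on which `P` has no zero:

* ★★ `euler_roots_Icc_le_budget` — `#{t ∈ [u,v] : E(t) = 0} ≤ 2·#{t ∈ [u,v] : E(t) = 0, E′(t)·P(t) ≥ 0} + 1`: the zeros of `E` in a pole-free window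
  are at most twice the RISER-DOMINATED ones plus one (two consecutive strict down-crossings of `E/P` are impossible — IVT);
* ★ `euler_roots_Icc_le_one_of_down` — if `E′(t)·P(t) < 0` at every zero of `E` in `[u,v]` then `E` has AT MOST ONE zero there (the chart-free
  form of every «type-β window» statement: ✓/⧗ `…ABWindow`, `…ABWindowMiddle` are instances where a strictly antitone normalisation exists);
* `eulerNumerator_roots_Icc_le_budget` — the same in the line's `eulerNumerator d a l₀` shape (every format `(m, K)`, every coupling).

This is the exact shape of val-idea-25 g3's located law AB4-riser («in a type-α window `I`, `V_I ≤ ρ_I`»): with `U_I = {t ∈ I : E(t) = 0,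
E′(t)P(t) ≥ 0}` the law reads `#U_I ≤ ρ_I`, and then `#zeros in I ≤ 2ρ_I + 1` by this file (p5 g14 certificates: equality at ρ_I = 2, 4).
HONEST FRAMING: framework; bounds nothing beyond `2·#U_I + 1`; NOT `OneChangeFloorK3`, not `stub_classRowK3`, not `stub_polyLaw`, not
`MatrixDescartes`, not Conjecture B; `VP ≠ VNP` is NOT proved.  No definitions, no named facts.
-/

set_option linter.dupNamespace false

namespace Summit.ValiantsHypothesis.ValiantsHypothesis.Theorems.LacunarySymmetroidMatrixDescartes

namespace ProductPlusOne

open Polynomial Finset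
open scoped BigOperators Topology

/-- Two distinct zeros `z < z'` of `E` with NO zero of `P` on `[z, z']` and `E′·P < 0` at both: there is a further zero of `E` strictly
between them. [folklore; IVT] -/
theorem exists_root_between_of_down (E P : ℝ[X]) {z z' : ℝ} (hzz' : z < z') (hPI : ∀ t ∈ Set.Icc z z', P.eval t ≠ 0)
    (hEz : E.eval z = 0) (hEz' : E.eval z' = 0)
    (hDz : (derivative E).eval z * P.eval z < 0) (hDz' : (derivative E).eval z' * P.eval z' < 0) :
    ∃ w, z < w ∧ w < z' ∧ E.eval w = 0 := by
  have hPz : P.eval z ≠ 0 := hPI z ⟨le_rfl, hzz'.le⟩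
  have hPz' : P.eval z' ≠ 0 := hPI z' ⟨hzz'.le, le_rfl⟩
  let g : ℝ → ℝ := fun y => E.eval y / P.eval y
  have hderiv : ∀ w, P.eval w ≠ 0 → E.eval w = 0 →
      HasDerivAt g ((derivative E).eval w * P.eval w / (P.eval w) ^ 2) w := by
    intro w hPw hEw
    have h1 := (Polynomial.hasDerivAt E w).div (Polynomial.hasDerivAt P w) hPw
    have : ((derivative E).eval w * P.eval w - E.eval w * (derivative P).eval w) / (P.eval w) ^ 2
        = (derivative E).eval w * P.eval w / (P.eval w) ^ 2 := by rw [hEw, zero_mul, sub_zero]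
    rw [this] at h1
    exact h1
  have hgz : g z = 0 := by show E.eval z / P.eval z = 0; rw [hEz, zero_div]
  have hgz' : g z' = 0 := by show E.eval z' / P.eval z' = 0; rw [hEz', zero_div]
  have hneg : (derivative E).eval z * P.eval z / (P.eval z) ^ 2 < 0 := div_neg_of_neg_of_pos hDz (sq_pos_iff.mpr hPz)
  have hneg' : (derivative E).eval z' * P.eval z' / (P.eval z') ^ 2 < 0 := div_neg_of_neg_of_pos hDz' (sq_pos_iff.mpr hPz')
  obtain ⟨δ, hδ, _, hright⟩ := exists_sign_nhds_of_hasDerivAt_neg (hderiv z hPz hEz) hgz hneg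
  obtain ⟨δ', hδ', hleft', _⟩ := exists_sign_nhds_of_hasDerivAt_neg (hderiv z' hPz' hEz') hgz' hneg'
  set a₁ := z + min (δ / 2) ((z' - z) / 3) with ha₁
  set b₁ := z' - min (δ' / 2) ((z' - z) / 3) with hb₁
  have hmin1 : 0 < min (δ / 2) ((z' - z) / 3) := lt_min (by linarith) (by linarith)
  have hmin2 : 0 < min (δ' / 2) ((z' - z) / 3) := lt_min (by linarith) (by linarith)
  have hmin1' : min (δ / 2) ((z' - z) / 3) ≤ (z' - z) / 3 := min_le_right _ _
  have hmin2' : min (δ' / 2) ((z' - z) / 3) ≤ (z' - z) / 3 := min_le_right _ _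
  have hmin1'' : min (δ / 2) ((z' - z) / 3) ≤ δ / 2 := min_le_left _ _
  have hmin2'' : min (δ' / 2) ((z' - z) / 3) ≤ δ' / 2 := min_le_left _ _
  have ha₁z : z < a₁ := by rw [ha₁]; linarith
  have hb₁z' : b₁ < z' := by rw [hb₁]; linarith
  have hab : a₁ < b₁ := by rw [ha₁, hb₁]; linarith
  have hga : g a₁ < 0 := hright a₁ ha₁z (by rw [ha₁]; linarith)
  have hgb : 0 < g b₁ := hleft' b₁ (by rw [hb₁]; linarith) hb₁z'
  have hcont : ContinuousOn g (Set.Icc a₁ b₁) := by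
    refine ContinuousOn.div (Polynomial.continuous E).continuousOn (Polynomial.continuous P).continuousOn ?_
    intro t ht
    exact hPI t ⟨ha₁z.le.trans ht.1, ht.2.trans hb₁z'.le⟩
  obtain ⟨w, hw, hgw⟩ : ∃ w ∈ Set.Ioo a₁ b₁, g w = 0 := by
    have := intermediate_value_Ioo hab.le hcont
    exact this ⟨hga, hgb⟩
  have hwz : z < w := ha₁z.trans hw.1
  have hwz' : w < z' := hw.2.trans hb₁z'
  have hPw : P.eval w ≠ 0 := hPI w ⟨hwz.le, hwz'.le⟩
  refine ⟨w, hwz, hwz', ?_⟩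
  have := hgw
  change E.eval w / P.eval w = 0 at this
  rcases div_eq_zero_iff.mp this with h | h
  · exact h
  · exact absurd h hPw

/-- ★★ **THE LOCAL CROSSING BUDGET** (every product, every level, every pole-free interval): with `E = X·P′ − C ν·P`,
`#{t ∈ [u,v] : E(t) = 0} ≤ 2·#{t ∈ [u,v] : E(t) = 0, E′(t)·P(t) ≥ 0} + 1`. [this file's theorem] -/
theorem euler_roots_Icc_le_budget {m : ℕ} (f : Fin m → ℝ[X]) (ν : ℝ) {u v : ℝ}
    (hP : ∀ t ∈ Set.Icc u v, (∏ j, f j).eval t ≠ 0) :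
    ((X * derivative (∏ j, f j) - C ν * ∏ j, f j).roots.toFinset.filter (fun t => u ≤ t ∧ t ≤ v)).card
      ≤ 2 * (((X * derivative (∏ j, f j) - C ν * ∏ j, f j).roots.toFinset.filter
          (fun t => (u ≤ t ∧ t ≤ v) ∧
            0 ≤ (derivative (X * derivative (∏ j, f j) - C ν * ∏ j, f j)).eval t * (∏ j, f j).eval t)).card) + 1 := by
  classical
  set P : ℝ[X] := ∏ j, f j with hPdef
  set E : ℝ[X] := X * derivative P - C ν * P with hEdef
  set T := E.roots.toFinset.filter (fun t => u ≤ t ∧ t ≤ v) with hT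
  by_cases hE0 : E = 0
  · have : T = ∅ := by rw [hT, hE0, roots_zero, Multiset.toFinset_zero, Finset.filter_empty]
    rw [this]; simp
  let Dn : ℝ → Prop := fun z => (derivative E).eval z * P.eval z < 0
  have hTmem : ∀ z ∈ T, E.eval z = 0 ∧ z ∈ Set.Icc u v := by
    intro z hz
    rw [hT, mem_filter, Multiset.mem_toFinset, mem_roots hE0] at hz
    exact ⟨hz.1, hz.2⟩
  have key := card_le_two_mul_card_filter_add_one T Dn (by
    intro z hz z' hz' hzz' hcons hDz hDz'
    obtain ⟨hEz, hzI⟩ := hTmem z hz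
    obtain ⟨hEz', hz'I⟩ := hTmem z' hz'
    have hPI : ∀ t ∈ Set.Icc z z', P.eval t ≠ 0 := fun t ht => hP t ⟨hzI.1.trans ht.1, ht.2.trans hz'I.2⟩
    obtain ⟨w, hwz, hwz', hEw⟩ := exists_root_between_of_down E P hzz' hPI hEz hEz' hDz hDz'
    refine hcons w ?_ ⟨hwz, hwz'⟩
    rw [hT, mem_filter, Multiset.mem_toFinset, mem_roots hE0]
    exact ⟨hEw, (hzI.1.trans hwz.le), (hwz'.le.trans hz'I.2)⟩)
  have hfilter : T.filter (fun z => ¬ Dn z)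
      = E.roots.toFinset.filter (fun t => (u ≤ t ∧ t ≤ v) ∧ 0 ≤ (derivative E).eval t * P.eval t) := by
    rw [hT, Finset.filter_filter]
    refine Finset.filter_congr fun z _ => ?_
    simp only [Dn, not_lt]
  rw [hfilter] at key
  exact key

/-- ★ **Chart-free «type β»**: on a pole-free interval on which EVERY zero of `E` is a strict down-crossing (`E′(t)·P(t) < 0`), `E` has at
most one zero. [this file's theorem] -/
theorem euler_roots_Icc_le_one_of_down {m : ℕ} (f : Fin m → ℝ[X]) (ν : ℝ) {u v : ℝ}
    (hP : ∀ t ∈ Set.Icc u v, (∏ j, f j).eval t ≠ 0)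
    (hdown : ∀ t ∈ Set.Icc u v, (X * derivative (∏ j, f j) - C ν * ∏ j, f j).eval t = 0 →
      (derivative (X * derivative (∏ j, f j) - C ν * ∏ j, f j)).eval t * (∏ j, f j).eval t < 0) :
    ((X * derivative (∏ j, f j) - C ν * ∏ j, f j).roots.toFinset.filter (fun t => u ≤ t ∧ t ≤ v)).card ≤ 1 := by
  classical
  have key := euler_roots_Icc_le_budget f ν hP
  set E : ℝ[X] := X * derivative (∏ j, f j) - C ν * ∏ j, f j with hE
  have hempty : (E.roots.toFinset.filter
      (fun t => (u ≤ t ∧ t ≤ v) ∧ 0 ≤ (derivative E).eval t * (∏ j, f j).eval t)) = ∅ := by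
    rw [Finset.filter_eq_empty_iff]
    rintro t ht ⟨htI, hge⟩
    by_cases hE0 : E = 0
    · rw [hE0, roots_zero, Multiset.toFinset_zero] at ht; exact absurd ht (Finset.notMem_empty _)
    rw [Multiset.mem_toFinset, mem_roots hE0] at ht
    exact absurd (hdown t htI ht) (not_lt.mpr hge)
  rw [hempty, Finset.card_empty, mul_zero, zero_add] at key
  exact key

/-- **The local crossing budget in the line's Euler-numerator shape** (every format `(m, K)`, support `d`, table `a`, coupling `l₀`;
✓ `eulerNumerator_eq_general`): on a pole-free `[u,v]`,
`#{zeros of R in [u,v]} ≤ 2·#{zeros t of R in [u,v] with R′(t)·F(t) ≥ 0} + 1`. [this file's theorem] -/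
theorem eulerNumerator_roots_Icc_le_budget {m K : ℕ} (d : Fin K → ℕ) (a : Fin m → Fin K → ℝ) (l₀ : Fin K) {u v : ℝ}
    (hP : ∀ t ∈ Set.Icc u v, (∏ j, ∑ l, C (a j l) * X ^ (d l) : ℝ[X]).eval t ≠ 0) :
    ((∑ j, (∑ l, C (a j l * ((d l : ℝ) - d l₀)) * X ^ (d l)) * ∏ i ∈ Finset.univ.erase j, (∑ l, C (a i l) * X ^ (d l))
        : ℝ[X]).roots.toFinset.filter (fun t => u ≤ t ∧ t ≤ v)).card
      ≤ 2 * (((∑ j, (∑ l, C (a j l * ((d l : ℝ) - d l₀)) * X ^ (d l)) * ∏ i ∈ Finset.univ.erase j,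
            (∑ l, C (a i l) * X ^ (d l)) : ℝ[X]).roots.toFinset.filter
          (fun t => (u ≤ t ∧ t ≤ v) ∧
            0 ≤ (derivative (∑ j, (∑ l, C (a j l * ((d l : ℝ) - d l₀)) * X ^ (d l)) * ∏ i ∈ Finset.univ.erase j,
              (∑ l, C (a i l) * X ^ (d l)) : ℝ[X])).eval t * (∏ j, ∑ l, C (a j l) * X ^ (d l) : ℝ[X]).eval t)).card) + 1 := by
  rw [eulerNumerator_eq_general]
  exact euler_roots_Icc_le_budget (fun j => ∑ l, C (a j l) * X ^ (d l)) _ hP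

end ProductPlusOne

end Summit.ValiantsHypothesis.ValiantsHypothesis.Theorems.LacunarySymmetroidMatrixDescartes
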